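import Summits.QuantumAdvantage.QuantumAdvantage.Theses.LinnikCubicClassGroups

/-!
# LadderDown — SUPERSEDED POINTER (forward generator G4, unit `fwd-ladder-QuantumAdvantage-50`)

The rung families below the crux `PureCubicClassNumberHard` (stmt-QuantumAdvantage-11826) that were first
published in this file (commit 2772db666c34: namespace
`Summit.QuantumAdvantage.QuantumAdvantage.Cruxes.PureCubicClassNumberHard.LadderDown` — `IsBlindOff`,
`JuntaRung`, the PROVED floor `juntaRung_zero`, `FiftyBlindBitsRung`, `OneBlindBitRung`, `juntaRung_id_iff`,
`CalibrationRung`, `RSACalibration`, …) now live VERBATIM, with the same fully-qualified names, as PART I of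

  `Summits/QuantumAdvantage/QuantumAdvantage/Cruxes/PureCubicClassNumberHard/Lines/JuntaLadder.lean`
  (module `Summits.QuantumAdvantage.QuantumAdvantage.Cruxes.PureCubicClassNumberHard.Lines.JuntaLadder`),

together with the line `JuntaLadder` (PART II) and its compiled witnesses (PART III).  Reason: new
crux-workfile modules are built by the farm with a multi-hour lag, so the line could not import this sibling
module in the same session; keeping both copies would declare the same names in two modules.  This file is
kept only as a pointer so that earlier evidence notes resolve; import the `Lines.JuntaLadder` module instead.
-/
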